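import Mathlib.Algebra.Order.BigOperators.Group.Finset
import Mathlib.Data.Real.Basic
import Mathlib.Data.Finset.Max
import Mathlib.Tactic.Linarith
import Mathlib.Tactic.Ring
import HarnessLib

/-!
# Heavy independent sets in bounded-degree graphs (the greedy bound `∑_I w ≥ ∑ w / (Δ + 1)`)

Support file for the renormalisation step of the Fröhlich–Spencer analysis of `U(1)₄`
(proof programme of the named fact
`Literature.MathematicalPhysics.QuantumFieldTheory.FrohlichSpencerU1PerimeterLawD4` and of its
corollary `Literature.Barriers.QuantumFields.AbelianDeconfinementD4`). FS82 §2.8, (2.61)–(2.62),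
p. 428: *"Given some current density `ρ ∈ 𝒩_γ`, it is easy to see that we can choose a subset `ℬ_ρ`
of links in `supp ρ` with the property that two different links in `ℬ_ρ` do not belong to a common
plaquette and that `∑_{xy ∈ ℬ_ρ} |ρ_{xy}|² ≥ c⁻¹ ‖ρ‖₂²`, where `c` is a purely geometrical constant,
namely `c = card{b' : b' ≠ b, b' ∈ ∂p for some p with b ∈ ∂p} + 1 = 19` in four dimensions"*
(the links of `ℬ_ρ` are then integrated out one at a time by Lemma 3, which requires that no two
of them interact through the Gaussian `(dα, dα)`).

This is the greedy weighted-independent-set bound, which we prove abstractly: for a symmetric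
"conflict" relation `R` on a finite set `S` in which every element has at most `Δ` conflicting
partners inside `S`, and non-negative weights `w`, there is an `R`-independent subset `I ⊆ S` with
`∑_{S} w ≤ (Δ + 1) ∑_{I} w` (`exists_independent_heavy`). Proof: pick an element of maximal
weight, discard it together with its `≤ Δ` partners (total discarded weight `≤ (Δ+1)·w_max`), and
recurse. Everything is proved; no named fact is introduced.

## References

* J. Fröhlich, T. Spencer, Comm. Math. Phys. 83 (1982) 411–454, §2.8 (2.61)–(2.62), p. 428.
  [FrohlichSpencerCMP1982]
-/

noncomputable section

open Finset
open scoped BigOperators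

namespace Literature.Probability.LatticeModels

namespace EnsembleExpansion

variable {B : Type*} [DecidableEq B]

/-- `I` is independent for the conflict relation `R`: no two distinct members conflict. [folklore] -/
def IsIndependentFor (R : B → B → Prop) (I : Finset B) : Prop :=
  ∀ a ∈ I, ∀ b ∈ I, a ≠ b → ¬ R a b

omit [DecidableEq B] in
/-- The empty set is independent. [folklore] -/
theorem isIndependentFor_empty (R : B → B → Prop) : IsIndependentFor R (∅ : Finset B) :=
  fun a ha => absurd ha (Finset.notMem_empty a)

open Classical in
/-- The conflicting partners of `a` inside `S`. [folklore] -/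
def partners (R : B → B → Prop) (S : Finset B) (a : B) : Finset B := S.filter fun b => b ≠ a ∧ R a b

open Classical in
/-- Membership in `partners`. [folklore] -/
theorem mem_partners {R : B → B → Prop} {S : Finset B} {a b : B} :
    b ∈ partners R S a ↔ b ∈ S ∧ b ≠ a ∧ R a b := by
  simp [partners]

/-- **The greedy bound for heavy independent sets.** Let `R` be a symmetric relation, `S` a finite
set in which every element has at most `Δ` `R`-partners inside `S`, and `w ≥ 0` weights on `S`.
Then some `R`-independent `I ⊆ S` carries at least the fraction `1/(Δ+1)` of the total weight:
`∑_{a ∈ S} w a ≤ (Δ + 1) ∑_{a ∈ I} w a`. (FS82 (2.61)–(2.62): `R` = "belong to a common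
plaquette", `Δ = 18`, `w = |ρ|²`.) [cite: FrohlichSpencerCMP1982, §2.8 (2.61)–(2.62) p. 428] -/
theorem exists_independent_heavy (R : B → B → Prop) (hR : ∀ a b, R a b → R b a) (Δ : ℕ)
    (w : B → ℝ) :
    ∀ S : Finset B, (∀ a ∈ S, (partners R S a).card ≤ Δ) → (∀ a ∈ S, 0 ≤ w a) →
      ∃ I : Finset B, I ⊆ S ∧ IsIndependentFor R I ∧
        ∑ a ∈ S, w a ≤ (Δ + 1) * ∑ a ∈ I, w a := by
  intro S
  induction S using Finset.strongInduction with
  | H S ih =>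
    intro hdeg hw
    rcases S.eq_empty_or_nonempty with rfl | hne
    · exact ⟨∅, subset_rfl, isIndependentFor_empty R, by simp⟩
    · -- an element of maximal weight
      obtain ⟨a, haS, hamax⟩ := Finset.exists_max_image S w hne
      -- discard `a` and its partners
      set D := insert a (partners R S a) with hD
      set S' := S \ D with hS'
      have hS'sub : S' ⊆ S := Finset.sdiff_subset
      have hS'ss : S' ⊂ S := Finset.ssubset_iff_subset_ne.2
        ⟨hS'sub, fun h => by
          have : a ∈ S' := h.symm ▸ haS
          rw [hS', Finset.mem_sdiff] at this
          exact this.2 (Finset.mem_insert_self _ _)⟩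
      have hdeg' : ∀ b ∈ S', (partners R S' b).card ≤ Δ := fun b hb =>
        (Finset.card_le_card (fun c hc => by
          rw [mem_partners] at hc ⊢
          exact ⟨hS'sub hc.1, hc.2⟩)).trans (hdeg b (hS'sub hb))
      obtain ⟨I', hI'sub, hI'ind, hI'sum⟩ := ih S' hS'ss hdeg' fun b hb => hw b (hS'sub hb)
      refine ⟨insert a I', Finset.insert_subset haS (hI'sub.trans hS'sub), ?_, ?_⟩
      · -- independence: members of `I' ⊆ S ∖ D` are not partners of `a`
        have key : ∀ b ∈ I', ¬ R a b ∧ ¬ R b a := by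
          intro b hb
          have hbS' := hI'sub hb
          rw [hS', Finset.mem_sdiff, hD, Finset.mem_insert, not_or, mem_partners] at hbS'
          obtain ⟨hbS, hba, hnp⟩ := hbS'
          have h1 : ¬ R a b := fun h => hnp ⟨hbS, hba, h⟩
          exact ⟨h1, fun h => h1 (hR b a h)⟩
        intro x hx y hy hxy
        rw [Finset.mem_insert] at hx hy
        rcases hx with rfl | hx <;> rcases hy with rfl | hy
        · exact absurd rfl hxy
        · exact (key y hy).1
        · exact (key x hx).2
        · exact hI'ind x hx y hy hxy
      · -- weights: `∑_S = ∑_{S ∩ D} + ∑_{S'}`, `∑_{S ∩ D} ≤ (Δ+1) w a`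
        have haI' : a ∉ I' := fun h => by
          have := hI'sub h
          rw [hS', Finset.mem_sdiff] at this
          exact this.2 (Finset.mem_insert_self _ _)
        rw [Finset.sum_insert haI']
        have hsplit : ∑ b ∈ S, w b = ∑ b ∈ S ∩ D, w b + ∑ b ∈ S', w b := by
          rw [hS', ← Finset.sum_sdiff (Finset.inter_subset_left : S ∩ D ⊆ S),
            Finset.sdiff_inter_self_left, add_comm]
        have hDcard : (S ∩ D).card ≤ Δ + 1 := by
          calc (S ∩ D).card ≤ D.card := Finset.card_le_card Finset.inter_subset_right
            _ ≤ (partners R S a).card + 1 := Finset.card_insert_le _ _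
            _ ≤ Δ + 1 := by have := hdeg a haS; omega
        have hDsum : ∑ b ∈ S ∩ D, w b ≤ (Δ + 1) * w a := by
          calc ∑ b ∈ S ∩ D, w b ≤ ∑ b ∈ S ∩ D, w a :=
                Finset.sum_le_sum fun b hb => hamax b (Finset.mem_inter.1 hb).1
            _ = (S ∩ D).card * w a := by rw [Finset.sum_const, nsmul_eq_mul]
            _ ≤ (Δ + 1) * w a := by
                have := hw a haS
                exact_mod_cast mul_le_mul_of_nonneg_right (by exact_mod_cast hDcard) this
        rw [hsplit]
        nlinarith [hI'sum, hDsum, hw a haS]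

end EnsembleExpansion

end Literature.Probability.LatticeModels
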